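import Summits.QuantumFields.BalabanUV.T4Continuum.Support.ShellMeasureWilsonTrace
import Summits.QuantumFields.BalabanUV.T4Continuum.Support.ShellMeasureScalingLocal
import Literature.MathematicalPhysics.QuantumFieldTheory.Balaban1983to89.T4ReTrLipUnitary

/-!
# `T4Continuum.ShellMeasureWilsonBlock` — (M1)₀: the LEVEL-0 INSTANCE of the smooth member (γ_loc) of the NE7c
# shell-measure frame — the sectioned Wilson block, assembled by the H-form scaling engine; the unitary matrix model
# (cell `pub-balaban`, sub-cell `t4`, spine estimate NE7c (node U5b); lineage t4-ne7c-p1 = PROVER seat P1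
# «shell-measure route», generation 25; file 3 of 4 (non-vacuity: `ShellMeasureWilsonToy`); ADDITIVE — imports `ShellMeasureWilsonTrace`,
# `ShellMeasureScalingLocal` (the engine, p200140) and `T4ReTrLipUnitary` (the trace/operator-norm comparison) only)

HONEST FRAMING.  Finite four-torus programme, rung (B)+1 only — NOT infinite volume, NOT a mass gap, NOT the Clay
problem, NOT summit progress; (B), `BetaPertHyp`, (B^μ) are not mentioned because nothing here consumes them.  The
cell wall of NE7c — (M1) `T4ShellMeasure.SlotAntiConcentration` FOR BAŁABAN'S INDUCTIVELY DEFINED EFFECTIVE MEASURES —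
is NOT PRINTED in [Balaban 1983–89] (GAPS G-ne7cp1-1), asserted by nobody, and NOT moved by this file: level `j = 0`
is in NE7c's live window only for `K ≤ N₁` ((W1)), and at the live levels `j ≥ 1` the two inputs (S-i)/(S-ii) concern
the localized minimiser `U_{j,□}(V)` (B14 (2.16); B11 Prop. 9 TYPE) and the effective action `A_j` (B12 Thm 1,
B14 (2.23) TYPE) — located, NOT PRINTED as instances, untouched.  What IS proved: at level 0 the two located inputs
of GAPS G-ne7cp1-21 ∕ -22 hold as [folklore] inequalities with explicit constants, and the engine turns them into
(M1)₀.  0 sorry, 0 citations.  HONEST DEPENDENCY (cell): continuum YM on T⁴ ⇐ BetaPertH ∧ nine spine estimates (0/9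
proved); BetaPertH ⇐ (D1) ∧ (D4) ∧ CAP+tail; G-an2-4 gates asym, D1 and NE2/3/4.

THE POINTS.
* §0 (S-ii)₀ PACKAGED (`wilsonAction_contract_sub_le`): for admissible sectioned words the Wilson action
  `S(c) = β Σ_p (1 − τ(G_p(c))/N)` satisfies `S(c) − S(1) ≤ (1−c)·B_f`, `B_f = β Σ_p s̄_p(d̄_p + 4 s̄_p)` — from the
  trace bound of `ShellMeasureWilsonTrace`.  ORDERS (reading, not kernel): with `s̄_p ≈ 4x₀`, `x₀ ≈ c₀Mθ₀` the axial
  reach ((LR)), `d̄_p ≲ 4x₀` (exterior in its own small-field window) and `β = g₀⁻²`, `θ₀ = ε₀ = A₀g₀p₀(g₀)`: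
  `B_f ≈ 80·g₀⁻²·#P_w·x₀² ≈ 80c₀²A₀²·#P_w·M²·p₀(g₀)²` — `g₀`-UNIFORM, polylogarithmic, the level-0 NUMBER behind the
  located «ℓ_j·x₀ polylog in log g_j⁻²» of G-ne7cp1-22.
* §1 THE UNITARY MATRIX MODEL (`matrixTrace`, `good_gen_of_mem_skewAdjoint`, `good_frozen_of_mem_unitary`): on
  `M_n(ℂ)` with the L²-operator norm (the cell's `dist1`, B7 (19)), `τ = Re Tr` is a trace datum with `N = n`
  (`|Re Tr a| ≤ n‖a‖` from `T4ReTrLipUnitary.abs_nReTr_sub_le`); skew-Hermitian generators are admissible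
  (`Re Tr Y = 0`; `exp(cY)` unitary, Mathlib `NormedSpace.exp_mem_unitary_of_mem_skewAdjoint`, hence of norm `1`);
  unitary frozen letters are admissible; and `1 − τ(U)/N = 1 − reTr U` is the plaquette energy of
  `Setup.wilsonAction4` in the cell's `UnitaryModel` (`one_sub_τ_div_eq`, `rfl`).
* §2 (M1)₀ ASSEMBLED (`slotAntiConcentration_levelZero`): in a finite-dimensional real chart `E` with additive Haar
  measure (the tree-gauged exponential coordinates of the block), with ray-linear generator lists for the classifier
  plaquettes and sectioned words for the weight plaquettes, a centre-monotone factor `J` supported in the window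
  (window × chart Jacobian × kept co-tests — `ShellMeasureScalingSU2` §1 for `SU(2)`), the sizes `s̄_u ≤ 1`,
  `s̄_p ≤ 1`, `d̄_p` on the window and (SM)₀ `4s̄_u²e^{2s̄_u} ≤ δθ`:
  `SlotAntiConcentration (μ.withDensity (J·e^{−S})) (max_p ‖hol_p − 1‖) θ ρ (2(dim E + B_f)/(1−δ))` for
  `0 ≤ ρ ≤ (1−δ)/2` — `ShellMeasureScalingLocal.slotAntiConcentration_of_coreMap_mul` at the depth
  `e^{−a} = 1 − ρ/(1−δ)`, (S-i)₀ = `ShellMeasureWilsonWords.coreMap_sup`, (S-ii)₀ = §0.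

DICTIONARY (located reading of B14 (2.16)–(2.18) at `k = 0`, not kernel): `E` = the Lie-algebra coordinates of the
non-tree bonds of the slot's block `□^{∼4}` after the tree gauge (`T4TreeGaugeFixing`; `ShellMeasureHeadlines` §1),
`Lu p x` = the (≤ 4) oriented generators of `∂p`, `p ⊂ □^∼` (interior by construction), `P_w` = the plaquettes of the
Wilson action meeting the block with exterior bonds FROZEN at the section `V` (letters `frozen (V b)`) and tree bonds
frozen at `1`; `β = 1/g₀²`, `θ = ε₀`, `J` = cube window × `e^{−jac_e}` (`ShellMeasureScalingSU2.chartWeight_le_smul`) ×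
kept co-tests; the dropped co-tests and the window insertion are the located (MR)/(LR) of the frame, unchanged.
The SU(2) realized form through `T4CubeChartExp.expFibreChart` needs in addition the identification of the
quaternionic one-bond chart `expPt` with `NormedSpace.exp` on `M₂(ℂ)` — a dictionary step not done here.

WHAT THIS DOES NOT DO.  No level `j ≥ 1`; no (MR)/(LR)/(W1)/(F∞)-rate; no Haar-measure realization; NE7c NOT
proved; 0/9 spine.
-/

noncomputable section

open NormedSpace Set MeasureTheory

namespace Summit.QuantumFields.BalabanUV.T4Continuum.ShellMeasureWilsonBlock

open scoped ENNReal
open Literature.MathematicalPhysics.QuantumFieldTheory.Balaban1983to89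
open T4ShellMeasure (SlotAntiConcentration)
open ShellMeasureWilsonWords ShellMeasureWilsonTrace
open ShellMeasureScalingLocal (slotAntiConcentration_of_coreMap_mul)

/-! ## §0 (S-ii)₀ packaged: the ray-weight loss of the sectioned Wilson action -/

section RayLoss

variable {A : Type*} [NormedRing A] [NormedAlgebra ℂ A] [CompleteSpace A] [NormOneClass A]

/-- **(S-ii)₀ — THE RAY-WEIGHT LOSS OF THE SECTIONED WILSON BLOCK ACTION.**  For a finite family of admissible
sectioned plaquette words `w p`, `p ∈ Ps`, with `s(w p) ≤ s̄_p ≤ 1` and `d(w p) ≤ d̄_p`, inverse coupling `β ≥ 0`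
and `N > 0`, the Wilson action `S(c) = β Σ_p (1 − τ(G_p(c))/N)` satisfies along the contraction
`S(c) − S(1) ≤ (1−c) · β Σ_p s̄_p(d̄_p + 4 s̄_p)` — the LEVEL-0 ray-weight constant
`B_f = β Σ_p s̄_p(d̄_p + 4 s̄_p)`, whose `d̄`-part is the block's linear response to the frozen exterior. [folklore] -/
theorem wilsonAction_contract_sub_le (T : TraceData A) (hN : 0 < T.N) {κ : Type*} (Ps : Finset κ)
    (w : κ → List (Letter A)) (hw : ∀ p ∈ Ps, ∀ ℓ ∈ w p, ℓ.Good T.τ) {sb db : κ → ℝ}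
    (hsb : ∀ p ∈ Ps, sGen (w p) ≤ sb p) (hsb1 : ∀ p ∈ Ps, sb p ≤ 1) (hdb : ∀ p ∈ Ps, dFro (w p) ≤ db p)
    {β : ℝ} (hβ : 0 ≤ β) {c : ℝ} (hc0 : 0 ≤ c) (hc1 : c ≤ 1) :
    β * ∑ p ∈ Ps, (1 - T.τ (wordEval c (w p)) / T.N) - β * ∑ p ∈ Ps, (1 - T.τ (wordEval 1 (w p)) / T.N) ≤
      (1 - c) * (β * ∑ p ∈ Ps, sb p * (db p + 4 * sb p)) := by
  rw [← mul_sub, ← Finset.sum_sub_distrib]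
  have hR : (1 - c) * (β * ∑ p ∈ Ps, sb p * (db p + 4 * sb p)) =
      β * ∑ p ∈ Ps, (1 - c) * (sb p * (db p + 4 * sb p)) := by
    rw [Finset.mul_sum, Finset.mul_sum, Finset.mul_sum]
    refine Finset.sum_congr rfl fun p _ => ?_
    ring
  rw [hR]
  refine mul_le_mul_of_nonneg_left (Finset.sum_le_sum fun p hp => ?_) hβ
  have hs1 : sGen (w p) ≤ 1 := (hsb p hp).trans (hsb1 p hp)
  have h := abs_trace_sub_le T (hw p hp) hs1 hc0 hc1
  have hs0 := sGen_nonneg (w p)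
  have hd0 := dFro_nonneg (w p)
  have h1c : 0 ≤ 1 - c := by linarith
  have hle : T.τ (wordEval 1 (w p) - wordEval c (w p)) ≤ (1 - c) * T.N * sb p * (db p + 4 * sb p) := by
    refine (le_abs_self _).trans (h.trans ?_)
    have hf : 0 ≤ (1 - c) * T.N := mul_nonneg h1c hN.le
    have hm : sGen (w p) * (dFro (w p) + 4 * sGen (w p)) ≤ sb p * (db p + 4 * sb p) :=
      mul_le_mul (hsb p hp) (add_le_add (hdb p hp) (mul_le_mul_of_nonneg_left (hsb p hp) (by norm_num)))
        (by positivity) (hs0.trans (hsb p hp))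
    have := mul_le_mul_of_nonneg_left hm hf
    linarith [this]
  rw [T.map_sub] at hle
  have e : 1 - T.τ (wordEval c (w p)) / T.N - (1 - T.τ (wordEval 1 (w p)) / T.N) =
      (T.τ (wordEval 1 (w p)) - T.τ (wordEval c (w p))) / T.N := by field_simp; ring
  rw [e, div_le_iff₀ hN]
  calc T.τ (wordEval 1 (w p)) - T.τ (wordEval c (w p)) ≤ (1 - c) * T.N * sb p * (db p + 4 * sb p) := hle
    _ = (1 - c) * (sb p * (db p + 4 * sb p)) * T.N := by ring

end RayLoss

/-! ## §1 The unitary matrix model: `Re Tr` is a trace datum; skew-Hermitian generators and unitary frozen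
letters are admissible -/

section MatrixModel

open scoped Matrix.Norms.L2Operator

variable {n : Type*} [Fintype n] [DecidableEq n] [Nonempty n]

/-- **`Re Tr` ON `M_n(ℂ)` IN THE OPERATOR NORM IS A TRACE DATUM** with constant `N = n`: real-additive, real-homogeneous,
`Re Tr(ab) = Re Tr(ba)`, `|Re Tr a| ≤ n‖a‖`. [folklore] -/
def matrixTrace : TraceData (Matrix n n ℂ) where
  τ M := (Matrix.trace M).re
  N := Fintype.card n
  map_add a b := by simp [Matrix.trace_add]
  map_smul r a := by simp [Matrix.trace_smul]
  comm a b := by rw [Matrix.trace_mul_comm]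
  abs_le a := by
    have h := T4ReTrLipUnitary.abs_nReTr_sub_le a 0
    have hc : (0 : ℝ) < Fintype.card n := Nat.cast_pos.mpr Fintype.card_pos
    simp only [UnitaryModel.nReTr, Matrix.trace_zero, Complex.zero_re, zero_div, sub_zero] at h
    rwa [abs_div, abs_of_pos hc, div_le_iff₀' hc] at h

/-- unfolding `τ`. [folklore] -/
@[simp] theorem matrixTrace_τ (M : Matrix n n ℂ) : (matrixTrace (n := n)).τ M = (Matrix.trace M).re := rfl

/-- unfolding `N`. [folklore] -/
@[simp] theorem matrixTrace_N : (matrixTrace (n := n)).N = Fintype.card n := rfl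

/-- `N = n > 0`. [folklore] -/
theorem matrixTrace_N_pos : 0 < (matrixTrace (n := n)).N := by
  rw [matrixTrace_N]; exact Nat.cast_pos.mpr Fintype.card_pos

omit [DecidableEq n] [Nonempty n] in
/-- a skew-Hermitian matrix has purely imaginary trace: `Re Tr Y = 0`. [folklore] -/
theorem re_trace_eq_zero_of_mem_skewAdjoint {Y : Matrix n n ℂ} (hY : Y ∈ skewAdjoint (Matrix n n ℂ)) :
    (Matrix.trace Y).re = 0 := by
  rw [skewAdjoint.mem_iff] at hY
  have h : star (Matrix.trace Y) = -Matrix.trace Y := by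
    rw [← Matrix.trace_conjTranspose, ← Matrix.star_eq_conjTranspose, hY, Matrix.trace_neg]
  have hre := congrArg Complex.re h
  rw [Complex.star_def, Complex.conj_re, Complex.neg_re] at hre
  linarith

omit [Fintype n] [DecidableEq n] [Nonempty n] in
/-- a real multiple of a skew-Hermitian matrix is skew-Hermitian. [folklore] -/
theorem real_smul_mem_skewAdjoint {Y : Matrix n n ℂ} (hY : Y ∈ skewAdjoint (Matrix n n ℂ)) (c : ℝ) :
    (c : ℂ) • Y ∈ skewAdjoint (Matrix n n ℂ) := by
  rw [skewAdjoint.mem_iff] at hY ⊢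
  rw [star_smul, hY, Complex.star_def, Complex.conj_ofReal, smul_neg]

/-- the exponential of a real multiple of a skew-Hermitian matrix is unitary, hence of operator norm `1`.
[folklore] -/
theorem norm_exp_real_smul_eq_one {Y : Matrix n n ℂ} (hY : Y ∈ skewAdjoint (Matrix n n ℂ)) (c : ℝ) :
    ‖exp ((c : ℂ) • Y)‖ = 1 := by
  letI : NormedAlgebra ℚ (Matrix n n ℂ) := NormedAlgebra.restrictScalars ℚ ℂ _
  have hu := exp_mem_unitary_of_mem_skewAdjoint (real_smul_mem_skewAdjoint hY c)
  exact CStarRing.norm_coe_unitary ⟨_, hu⟩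

/-- **SKEW-HERMITIAN GENERATORS ARE ADMISSIBLE** for `Re Tr`: `Re Tr Y = 0` and every `exp(cY)` is a contraction.
[folklore] -/
theorem good_gen_of_mem_skewAdjoint {Y : Matrix n n ℂ} (hY : Y ∈ skewAdjoint (Matrix n n ℂ)) :
    (Letter.gen Y).Good (matrixTrace (n := n)).τ :=
  ⟨re_trace_eq_zero_of_mem_skewAdjoint hY, fun c _ _ => (norm_exp_real_smul_eq_one hY c).le⟩

/-- **UNITARY FROZEN LETTERS ARE ADMISSIBLE** (operator norm `1`). [folklore] -/
theorem good_frozen_of_mem_unitary {a : Matrix n n ℂ} (ha : a ∈ unitary (Matrix n n ℂ)) :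
    (Letter.frozen a).Good (matrixTrace (n := n)).τ :=
  (CStarRing.norm_coe_unitary ⟨a, ha⟩).le

/-- DICTIONARY with the Wilson action of `Setup`: for a unitary `U`, the plaquette energy `1 − Re Tr U / n` of the
trace datum is `1 − reTr U` of the cell's unitary model (`UnitaryModel.nReTr`). [folklore] -/
theorem one_sub_τ_div_eq (U : Matrix n n ℂ) :
    1 - (matrixTrace (n := n)).τ U / (matrixTrace (n := n)).N = 1 - UnitaryModel.nReTr U := rfl

/-- DICTIONARY, `G = U(n)` (the cell's instance `UnitaryModel.instGaugeGroupUnitaryGroup`): the plaquette energy of the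
trace datum at the holonomy IS the Wilson plaquette energy `1 − reTr U(∂p)` of `Setup.wilsonAction4`, and the
classifier's `‖U(∂p) − 1‖` IS `dist1 (U(∂p))` (B7 (19), operator norm) — both by `rfl`. [folklore] -/
theorem wilson_dictionary_unitaryGroup (U : Matrix.unitaryGroup n ℂ) :
    1 - (matrixTrace (n := n)).τ (U : Matrix n n ℂ) / (matrixTrace (n := n)).N = 1 - reTr U ∧
      ‖(U : Matrix n n ℂ) - 1‖ = dist1 U := ⟨rfl, rfl⟩

/-- DICTIONARY, `G = SU(n)` (the cell's instance `UnitaryModel.instGaugeGroupSpecialUnitaryGroup`; B12 Thm 2's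
production group is `SU(2)`): the same two identities, by `rfl`. [folklore] -/
theorem wilson_dictionary_specialUnitaryGroup (U : Matrix.specialUnitaryGroup n ℂ) :
    1 - (matrixTrace (n := n)).τ (U : Matrix n n ℂ) / (matrixTrace (n := n)).N = 1 - reTr U ∧
      ‖(U : Matrix n n ℂ) - 1‖ = dist1 U := ⟨rfl, rfl⟩

end MatrixModel

/-! ## §2 (M1)₀ — the level-0 instance assembled by the H-form engine -/

section Assembly

variable {E : Type*} [NormedAddCommGroup E] [NormedSpace ℝ E] [MeasurableSpace E] [BorelSpace E]
  [FiniteDimensional ℝ E] (μ : Measure E) [μ.IsAddHaarMeasure]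
variable {A : Type*} [NormedRing A] [NormedAlgebra ℂ A] [CompleteSpace A] [NormOneClass A]

/-- THE LEVEL-0 CLASSIFIER read in the chart: `u(x) = max_{p ∈ P_u} ‖hol_p(x) − 1‖`, `hol_p(x)` the word of
exponentials of the generators `Lu p x` of `∂p` (the verbatim tested variable `sup_p |V(∂p) − 1|` of B14 (2.17) at
`j = 0`, for the plaquettes of the slot, in the tree gauge). [folklore] -/
def classifier {ι : Type*} {Pu : Finset ι} (hPu : Pu.Nonempty) (Lu : ι → E → List A) (x : E) : ℝ :=
  Pu.sup' hPu fun p => ‖wordExp (Lu p x) - 1‖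

/-- THE SECTIONED LEVEL-0 WILSON ACTION read in the chart: `S(x) = β Σ_{p ∈ P_w} (1 − τ(G_p(x))/N)` over the
plaquettes meeting the block, `G_p(x)` the sectioned word (block generators and frozen exterior / tree letters).
[folklore] -/
def action (T : TraceData A) (β : ℝ) {κ : Type*} (Pw : Finset κ) (Lw : κ → E → List (Letter A)) (x : E) : ℝ :=
  β * ∑ p ∈ Pw, (1 - T.τ (wordEval 1 (Lw p x)) / T.N)

/-- the Boltzmann weight `e^{−S(x)}` of the sectioned level-0 Wilson action. [folklore] -/
def weight (T : TraceData A) (β : ℝ) {κ : Type*} (Pw : Finset κ) (Lw : κ → E → List (Letter A)) (x : E) : ℝ≥0∞ :=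
  ENNReal.ofReal (Real.exp (-action T β Pw Lw x))

omit [NormedSpace ℝ E] [MeasurableSpace E] [BorelSpace E] [FiniteDimensional ℝ E] [NormedAlgebra ℂ A]
  [CompleteSpace A] [NormOneClass A] in
/-- the classifier is continuous (hence measurable) when the words are. [folklore] -/
theorem continuous_classifier {ι : Type*} {Pu : Finset ι} (hPu : Pu.Nonempty) {Lu : ι → E → List A}
    (hcont : ∀ p ∈ Pu, Continuous fun x => wordExp (Lu p x)) : Continuous (classifier hPu Lu) :=
  Continuous.finset_sup'_apply hPu fun p hp => continuous_norm.comp ((hcont p hp).sub continuous_const)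

/-- **(M1)₀ — THE LEVEL-0 INSTANCE OF THE SMOOTH MEMBER (γ_loc).**  DATA, read in a finite-dimensional real chart
`E` with additive Haar measure `μ` (the tree-gauged exponential coordinates of the slot's block): a trace datum `T`
(`Re Tr`, `N > 0`); classifier plaquettes `P_u ≠ ∅` with generator lists `Lu p x`, RAY-LINEAR
(`Lu p (c•x) = c·Lu p x`) and continuous; weight plaquettes `P_w` with sectioned words `Lw p x` whose generators are
ray-linear and whose frozen letters do not move (`wordEval 1 (Lw p (c•x)) = wordEval c (Lw p x)`); a factor `J`
(window indicator × chart Jacobian × kept co-tests) supported in the window `W` and non-decreasing towards the centre;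
on the window: generator sizes `Σ_{∂p}‖Y‖ ≤ s̄_u ≤ 1` (classifier), admissible letters, `s(Lw p x) ≤ s̄_p ≤ 1`,
`d(Lw p x) ≤ d̄_p` (weight); numbers `θ > 0`, `0 ≤ δ < 1`, `0 ≤ ρ ≤ (1−δ)/2`, `β ≥ 0`, and THE LEVEL-0 SMALLNESS
(SM)₀ `4 s̄_u² e^{2 s̄_u} ≤ δ·θ`; finite sub-threshold mass.  CONCLUSION:
`SlotAntiConcentration (μ.withDensity (J · e^{−S})) u θ ρ D` with
`D = 2·(dim E + B_f)/(1−δ)`, `B_f = β Σ_{p ∈ P_w} s̄_p(d̄_p + 4 s̄_p)`.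
PROOF: `ShellMeasureScalingLocal.slotAntiConcentration_of_coreMap_mul` at the depth `e^{−a} = 1 − ρ/(1−δ)` with
(S-i)₀ = `coreMap_sup` and (S-ii)₀ = `wilsonAction_contract_sub_le`.  Nothing of Bałaban's inductive levels `j ≥ 1`
is touched. [folklore] -/
theorem slotAntiConcentration_levelZero (T : TraceData A) (hN : 0 < T.N)
    {ι κ : Type*} {Pu : Finset ι} (hPu : Pu.Nonempty) (Lu : ι → E → List A)
    (Pw : Finset κ) (Lw : κ → E → List (Letter A)) {W : Set E} {J : E → ℝ≥0∞}
    {θ δ ρ β su : ℝ} {sw dw : κ → ℝ}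
    (hLu : ∀ p ∈ Pu, ∀ x : E, ∀ c : ℝ, 0 ≤ c → c ≤ 1 → Lu p (c • x) = scale c (Lu p x))
    (hLw : ∀ p ∈ Pw, ∀ x : E, ∀ c : ℝ, 0 ≤ c → c ≤ 1 → wordEval 1 (Lw p (c • x)) = wordEval c (Lw p x))
    (hcont : ∀ p ∈ Pu, Continuous fun x => wordExp (Lu p x))
    (hJW : ∀ x, J x ≠ 0 → x ∈ W) (hJ : ∀ x, ∀ a : ℝ, 0 ≤ a → J x ≤ J (Real.exp (-a) • x))
    (hsu : ∀ x ∈ W, ∀ p ∈ Pu, normSum (Lu p x) ≤ su) (hsu1 : su ≤ 1)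
    (hgood : ∀ x ∈ W, ∀ p ∈ Pw, ∀ ℓ ∈ Lw p x, ℓ.Good T.τ)
    (hsw : ∀ x ∈ W, ∀ p ∈ Pw, sGen (Lw p x) ≤ sw p) (hsw0 : ∀ p ∈ Pw, 0 ≤ sw p) (hsw1 : ∀ p ∈ Pw, sw p ≤ 1)
    (hdw : ∀ x ∈ W, ∀ p ∈ Pw, dFro (Lw p x) ≤ dw p) (hdw0 : ∀ p ∈ Pw, 0 ≤ dw p)
    (hθ : 0 < θ) (hδ0 : 0 ≤ δ) (hδ1 : δ < 1) (hρ0 : 0 ≤ ρ) (hρ : ρ ≤ (1 - δ) / 2) (hβ : 0 ≤ β)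
    (hSM : 4 * su ^ 2 * Real.exp (2 * su) ≤ δ * θ)
    (hfin : (μ.withDensity fun x => J x * weight T β Pw Lw x) {x | classifier hPu Lu x < θ} ≠ ∞) :
    SlotAntiConcentration (μ.withDensity fun x => J x * weight T β Pw Lw x) (classifier hPu Lu) θ ρ
      (2 * (Module.finrank ℝ E + β * ∑ p ∈ Pw, sw p * (dw p + 4 * sw p)) / (1 - δ)) := by
  -- the depth
  have h1δ : 0 < 1 - δ := by linarith
  set ρ' := ρ / (1 - δ) with hρ'
  have hρ'0 : 0 ≤ ρ' := div_nonneg hρ0 h1δ.le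
  have hρ'2 : ρ' ≤ 1 / 2 := by rw [hρ', div_le_iff₀ h1δ]; linarith
  set a := -Real.log (1 - ρ') with ha
  have hc0 : 0 < 1 - ρ' := by linarith
  have hc1 : 1 - ρ' ≤ 1 := by linarith
  have hexp : Real.exp (-a) = 1 - ρ' := by rw [ha, neg_neg, Real.exp_log hc0]
  have ha0 : 0 ≤ a := by rw [ha, neg_nonneg]; exact Real.log_nonpos hc0.le hc1
  have ha2 : a ≤ 2 * ρ' := T4ShellMeasureFibre.neg_log_one_sub_le hρ'0 hρ'2
  have h1ca : 1 - (1 - ρ') ≤ a := by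
    have h := Real.log_le_sub_one_of_pos hc0
    rw [ha]; linarith
  set Bf := β * ∑ p ∈ Pw, sw p * (dw p + 4 * sw p) with hBf
  have hBf0 : 0 ≤ Bf := by
    rw [hBf]
    exact mul_nonneg hβ (Finset.sum_nonneg fun p hp =>
      mul_nonneg (hsw0 p hp) (add_nonneg (hdw0 p hp) (mul_nonneg (by norm_num) (hsw0 p hp))))
  have hu : Measurable (classifier hPu Lu) := (continuous_classifier hPu hcont).measurable
  refine slotAntiConcentration_of_coreMap_mul μ hu (a := a) (Bf := Bf) hθ.le hρ0 hfin (fun x => hJ x a ha0)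
    ?_ ?_ ?_
  · -- (S-i)₀: the core map
    intro x hx hJx _
    have hxW : x ∈ W := hJW x hJx
    rw [hexp]
    have hrw : classifier hPu Lu ((1 - ρ') • x) = Pu.sup' hPu fun p => ‖wordExp (scale (1 - ρ') (Lu p x)) - 1‖ := by
      unfold classifier
      exact Finset.sup'_congr hPu rfl fun p hp => by rw [hLu p hp x (1 - ρ') hc0.le hc1]
    rw [hrw]
    refine coreMap_sup hPu (fun p => Lu p x) hc0 hc1 (fun p hp => (hsu x hxW p hp).trans hsu1) hθ
      (fun p hp => (interpConst_mono (normSum_nonneg _) (hsu x hxW p hp)).trans hSM) ?_ hx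
    rw [hρ']
    exact depth_admissible hδ0 hδ1 hρ0
  · -- (S-ii)₀: the ray-weight loss of the Wilson weight
    intro x hx hJx _
    have hxW : x ∈ W := hJW x hJx
    rw [hexp]
    unfold weight action
    have hS : β * ∑ p ∈ Pw, (1 - T.τ (wordEval 1 (Lw p ((1 - ρ') • x))) / T.N) =
        β * ∑ p ∈ Pw, (1 - T.τ (wordEval (1 - ρ') (Lw p x)) / T.N) := by
      congr 1
      exact Finset.sum_congr rfl fun p hp => by rw [hLw p hp x (1 - ρ') hc0.le hc1]
    rw [hS]
    have hdiff := wilsonAction_contract_sub_le T hN Pw (fun p => Lw p x) (hgood x hxW) (hsw x hxW) hsw1 (hdw x hxW)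
      hβ hc0.le hc1
    rw [← hBf] at hdiff
    have hle : β * ∑ p ∈ Pw, (1 - T.τ (wordEval (1 - ρ') (Lw p x)) / T.N) -
        β * ∑ p ∈ Pw, (1 - T.τ (wordEval 1 (Lw p x)) / T.N) ≤ Bf * a :=
      hdiff.trans (by nlinarith)
    rw [← ENNReal.ofReal_mul (Real.exp_pos _).le, ← Real.exp_add]
    exact ENNReal.ofReal_le_ofReal (Real.exp_le_exp.2 (by linarith))
  · -- the constant
    have hn : (0 : ℝ) ≤ Module.finrank ℝ E + Bf := by positivity
    calc (Module.finrank ℝ E + Bf) * a ≤ (Module.finrank ℝ E + Bf) * (2 * ρ') := mul_le_mul_of_nonneg_left ha2 hn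
      _ = 2 * (Module.finrank ℝ E + Bf) / (1 - δ) * ρ := by rw [hρ']; field_simp

end Assembly

end Summit.QuantumFields.BalabanUV.T4Continuum.ShellMeasureWilsonBlock
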